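import Summits.QuantumFields.BalabanUV.Beta.D1BFx.TorusGaugeBasisC
import Summits.QuantumFields.BalabanUV.Beta.D1BFx.TorusGaugeBasisMatrix

/-!
# `BalabanUV.Beta.D1BFx.TorusGaugeBasisMatrixC` — road «BF-x», binder row D1, slot (K), PART 23 (an2 R-D1-g43-1 ∕ OWNER d1-p2 g22 F-g22-1 §4 «TB3b′»),
# brick **TB3b′ «THE GAUGE BASIS FROM THE COMB ON THE TORUS AT CHART (III′)»** PART 2 — the comb twin of `TorusGaugeBasisMatrix`: the CENTRED-TREE
# basis matrix `N̂′` on the fine torus and **`Ŵ′₀ = ĝrad · N̂′`** — the columns of PART 1's `What0C = (1 − Π̂′)·τ_Tᵀ` ARE the fine-torus gradients of the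
# periodised CENTRED TREE gauge functions `λ′_b = treeGaugeAt ρ_c δ_b n` (root `ρ_c = ctr (d+1) n`; NO block-mean subtraction) of the comb bonds `b`.

WHY (F-g22-1 §4∕§5, Q-g22-2): at chart (III′) the gauge modes of the shifted border `[K; Q̂ + D̂sh]` are the gradients of the CENTRED TREE gauge functions
(`CombChartSpreadBlind.comp_bhKStepSh_trK_piK`), so the generator pin of the [W] rows reads `x₁ = Djet·N̂′` with THIS `N̂′` (R-D1-g43-1 (W-b) «`Nhat (ctrOff 4 n)`»
made precise: the rooted-axial basis at `ctrOff`, not the block-mean one).  This file is `TorusGaugeBasisMatrix` §1–§3 with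
`(bmGaugeAt (toSite r), piKBm, bmGaugeAt_delta1_eq_zero, abs_bmGaugeAt_le_blockMass, piKBm_inl_inl_eq ∘ axProjBmAt) ↦
 (treeGaugeAt ρ_c, piK ρ_c, treeGaugeAt_delta1_eq_zero, abs_treeGaugeAt_le_blockMass, piK_inl_inl_eq ∘ axProjAt_apply)`; the lattice gradient `dzF`, the torus
gradient `gradHat`, `tsum_dzKer_mul`, `blockMass_delta1_le_one`, `periodiseF_sub_matrix` are REUSED from the template BY NAME; no `hr` hypothesis (`ρ_c = toSite (ctrOff (d+1) n)`).

CONTENT ([folklore] periodisation bookkeeping; fine torus `Site (d+1) (n·p)`):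
* §1 [our objects] `tgF n` (`(w, (X,β)) ↦ λ′_{(β,X)}(w)`), `NhatFC n s` (all fine bonds), **`NhatC n p`** (comb columns, `Matrix (Site (d+1) (n·p)) (CombRows ρ_c n p)`);
  `NhatFC_eq_submatrix`, `gradHat_mul_NhatFC_eq`.
* §2 `isPeriodic₂_tgF`, `abs_tgF_le` (`≤ (d+1)·n`), `rowBound_tgF`, **`compF_dzF_tgF : dzF ∘ tgF = δ − (Π′ᵀ)_ff`** ON THE LATTICE (`grad λ′_b = δ_b − Π_c δ_b`).
* §3 **`gradHat_mul_NhatFC : ĝrad · N̂′F = 1 − ((Π′ᵀ)_ff)^`**, `PiHatC_eq_submatrix`, **`one_sub_PiHatC_eq`**, `mul_tauT_transpose_apply_ctr`,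
  **`What0C_eq_grad_NhatC : What0C n p = (gradHat (n·p)).submatrix (e₁ n p) id * NhatC n p`**.

HONEST FRAMING (cell contract, verbatim): «discharging `BetaPertH` makes Bałaban's UV stability UNCONDITIONAL — a real constructive-QFT result; it
is NOT the continuum limit and NOT the Clay problem.»  HONEST DEPENDENCY (verbatim): «continuum YM on T⁴ ⇐ BetaPertH ∧ nine spine estimates (0/9
proved); BetaPertH ⇐ (D1) ∧ (D4) ∧ CAP+tail; G-an2-4 gates asym, D1 and NE2/3/4.»  [folklore] bookkeeping BY NAME; no `Prop` is minted, nothing is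
cited, no wall binder is instantiated; 0 sorry.  Discharges NOTHING of (K), of hW ∕ hR ∕ D1Tel ∕ D1Rep (0∕4), of D1 or of BetaPertH; NOT continuum, NOT Clay.
ABSOLUTE RULE (cell, verbatim): «No internally-minted statement may enter as a cited fact. Every hypothesis is either kernel-proved in this package or a
verbatim quotation of a PUBLISHED theorem with page reference. The manuscript(s) under audit are NOT citable for their own disputed steps — they are the
thing under adjudication; programme-internal (2001/route/tribunal) claims are never citable.»  Provenance: D1 formalisation swarm, unit
`b2b-balaban-beta-d1-formalise-leaf-03` (gen 28), brick «K-TB3b′», 2026-08-22; template `TorusGaugeBasisMatrix` (gen 8); no existing file touched.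
-/

noncomputable section

namespace Summit.QuantumFields.BalabanUV.Beta.D1BFx.TorusGaugeBasisMatrixC

open Matrix
open Literature.Probability.LatticeModels (TorusSite Torus.proj)
open Literature.MathematicalPhysics.QuantumFieldTheory.LatticeForm (repZ quo)
open Literature.MathematicalPhysics.QuantumFieldTheory.Balaban1983to89
open Literature.MathematicalPhysics.QuantumFieldTheory.Balaban1983to89.Beta
open RootedComb (axProjAt_apply)
open ExpKernelCalculus (MKer Decays comp shiftK)
open AffineAveraging (box toSite unitVec blockSum)
open AveragingContours (blk grad shift blk_block)
open AveragingContoursRooted (treeGaugeAt ctr ctrOff ctrOff_mem_box)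
open AxialProjector (blk_add_zsmul toSite_injective)
open AxialDressing (blockMass)
open KKTFluctuationKernel (delta1 delta1_apply)
open OneStepResolventKernel (Fib)
open Summit.QuantumFields.BalabanUV.Beta.TameKernelCalculus (Spr trK trK_apply)
open Summit.QuantumFields.BalabanUV.Beta.AxialDressingRooted (IsCombBondAt piK shiftK_piK spr_trK_piK treeGaugeAt_shift)
open Summit.QuantumFields.BalabanUV.Beta.SymRootedAveragingMatrix (piK_inl_inl_eq)
open Summit.QuantumFields.BalabanUV.Beta.BorderedHessian (treeGaugeAt_delta1_eq_zero)
open Summit.QuantumFields.BalabanUV.Beta.GAN24.RespStepBmDecompExact (abs_treeGaugeAt_le_blockMass)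
open Summit.QuantumFields.BalabanUV.Beta.D1BFx.FibredPeriodisation
open Summit.QuantumFields.BalabanUV.Beta.D1BFx.SortedKernels
open Summit.QuantumFields.BalabanUV.Beta.D1BFx.SortedReblocking
open Summit.QuantumFields.BalabanUV.Beta.D1BFx.SortedPack
open Summit.QuantumFields.BalabanUV.Beta.D1BFx.SortedEmbedding (e₁ e₁_apply periodiseF_reblock_eq_submatrix)
open Summit.QuantumFields.BalabanUV.Beta.D1BFx.SortedEmbeddingWall (isPeriodic₂_of_blockCov periodiseF_neg')
open Summit.QuantumFields.BalabanUV.Beta.D1BFx.PackedKernelSplit (blk_tt)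
open Summit.QuantumFields.BalabanUV.Beta.D1BFx.PeriodicArrays (toF Kfib_toF)
open Summit.QuantumFields.BalabanUV.Beta.D1BFx.StencilKernels (dzKer isPeriodic₂_dzKer summable_dzKer_row)
open Summit.QuantumFields.BalabanUV.Beta.D1BFx.TorusCombKKT (I J CombRows tauT tauT_apply)
open Summit.QuantumFields.BalabanUV.Beta.D1BFx.TorusGaugeBasisC (PiHatC What0C shiftK_trK_piK_ctr)
open Summit.QuantumFields.BalabanUV.Beta.D1BFx.TorusGaugeBasisMatrix (dzF gradHat gradHat_eq_submatrix shift_delta1 summable_abs_dzF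
  blockMass_delta1_le_one tsum_dzKer_mul periodiseF_sub_matrix summable_Kfib_kdeltaF)
open scoped BigOperators

variable {d : ℕ} (n p : ℕ) [NeZero n] [NeZero p]

/-! ## §1 The lattice kernel of the centred tree gauge functions and the torus matrices -/

/-- [our object] **THE CENTRED TREE GAUGE FUNCTIONS AS A FIBRED KERNEL**: rows = sites `(w, ⋆)`, columns = bonds `(X, β)`, entry
`λ′_{(β,X)}(w) = treeGaugeAt ρ_c δ_{(β,X)} n w` (root `ρ_c = ctr (d+1) n`; no block-mean subtraction). -/
def tgF : FKer (d + 1) Unit (Fin (d + 1)) := fun i j => treeGaugeAt (ctr (d + 1) n) (delta1 j.2 j.1) n i.1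

/-- [our object] The periodised centred tree gauge functions of ALL fine bonds: `N̂′F x (X̄, β) = Σ_images λ′_{(β,X)}(x)`. -/
def NhatFC (s : ℕ) [NeZero s] : Matrix (Beta.Site (d + 1) s) (Beta.Site (d + 1) s × Fin (d + 1)) ℝ :=
  Matrix.of fun x j => periodise₂ s (fun w X => treeGaugeAt (ctr (d + 1) n) (delta1 j.2 X) n w) x j.1

/-- [our object] **THE BASIS MATRIX `N̂′`**: column `b` = the periodised centred tree gauge function of the comb bond `b` on the fine torus `Site (d+1) (n·p)`
(the comb bond read as a fine-torus bond through `SortedEmbedding.e₁`). -/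
def NhatC : Matrix (Beta.Site (d + 1) (n * p)) (CombRows (ctr (d + 1) n) n p) ℝ := fun x b => NhatFC (d := d) n (n * p) x (e₁ n p b.1)

/-- [our object] `NhatC` through `NhatFC`, by `rfl`. -/
theorem NhatC_apply (x : Beta.Site (d + 1) (n * p)) (b : CombRows (ctr (d + 1) n) n p) :
    NhatC (d := d) n p x b = NhatFC (d := d) n (n * p) x (e₁ n p b.1) := rfl

section Bridge
variable (s : ℕ) [NeZero s]

omit [NeZero n] in
/-- [our object] `N̂′F` is the fibred periodisation of `tgF` (trivial row fibre). -/
theorem NhatFC_eq_submatrix :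
    NhatFC (d := d) n s = (Matrix.of (periodiseF s (tgF (d := d) n))).submatrix (Equiv.prodPUnit _).symm id := by
  ext x ⟨X, β⟩
  rfl

omit [NeZero n] in
/-- [folklore] Hence `ĝrad · N̂′F = (dzF)^ · (tgF)^` (the trivial fibre summed out). -/
theorem gradHat_mul_NhatFC_eq :
    gradHat (d := d) s * NhatFC (d := d) n s = Matrix.of (periodiseF s (dzF (d := d))) * Matrix.of (periodiseF s (tgF (d := d) n)) := by
  ext i j
  rw [Matrix.mul_apply, Matrix.mul_apply, Fintype.sum_prod_type]
  refine Finset.sum_congr rfl fun x _ => ?_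
  rw [Fintype.sum_unique]
  rfl

end Bridge

/-! ## §2 Periodicity, row bounds; the lattice identity `dzF ∘ tgF = δ − (Π′ᵀ)_ff` -/

omit [NeZero p] in
/-- [folklore] The fibres of `tgF` are jointly `n·p`-periodic (block structure of period `n ∣ n·p`; `treeGaugeAt_shift`). -/
theorem isPeriodic₂_tgF (b : Unit) (β : Fin (d + 1)) : IsPeriodic₂ (n * p) (Kfib (tgF (d := d) n) b β) := by
  intro w X t
  rw [Kfib_apply, Kfib_apply]
  show treeGaugeAt (ctr (d + 1) n) (delta1 β (imageShift (n * p) X t)) n (imageShift (n * p) w t)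
    = treeGaugeAt (ctr (d + 1) n) (delta1 β X) n w
  rw [imageShift_mul_eq_add, imageShift_mul_eq_add, treeGaugeAt_shift _ (NeZero.one_le (n := n)), shift_delta1]

/-- [folklore] **UNIFORM BOUND** `|λ′_{(β,X)}(w)| ≤ (d+1)n` (`abs_treeGaugeAt_le_blockMass` + `blockMass_delta1_le_one`). -/
theorem abs_tgF_le (w X : Fin (d + 1) → ℤ) (β : Fin (d + 1)) :
    |treeGaugeAt (ctr (d + 1) n) (delta1 β X) n w| ≤ ((d : ℝ) + 1) * n := by
  have hn : 1 ≤ n := NeZero.one_le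
  have h := abs_treeGaugeAt_le_blockMass hn (ctrOff_mem_box (d := d + 1) hn) (delta1 β X) w
  have hm := blockMass_delta1_le_one n β X (blk n w)
  have hpos : 0 ≤ ((d : ℝ) + 1) * n := by positivity
  rw [show ctr (d + 1) n = toSite (ctrOff (d + 1) n) from rfl]
  nlinarith

/-- [folklore] **ROW BOUND FOR `tgF`**: for fixed `w`, `X ↦ λ′_{(β,X)}(w)` is supported in the cube `|X_j − w_j| ≤ n` (`treeGaugeAt_delta1_eq_zero`), each
entry at most `(d+1)n`. -/
theorem rowBound_tgF (b : Unit) (β : Fin (d + 1)) :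
    RowBound (Kfib (tgF (d := d) n) b β) (((2 * n + 1) ^ (d + 1) : ℕ) * (((d : ℝ) + 1) * n)) := by
  have hn : 1 ≤ n := NeZero.one_le
  have hr : ctrOff (d + 1) n ∈ box (d + 1) n := ctrOff_mem_box hn
  intro w
  set S : Finset (Fin (d + 1) → ℤ) := Fintype.piFinset fun j : Fin (d + 1) => Finset.Icc (w j - n) (w j + n) with hS
  have hzero : ∀ X ∉ S, Kfib (tgF (d := d) n) b β w X = 0 := by
    intro X hX
    rw [hS, Fintype.mem_piFinset] at hX
    obtain ⟨j, hj⟩ := not_forall.mp hX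
    rw [Finset.mem_Icc, not_and_or, not_le, not_le] at hj
    rw [Kfib_apply]
    show treeGaugeAt (ctr (d + 1) n) (delta1 β X) n w = 0
    rw [show ctr (d + 1) n = toSite (ctrOff (d + 1) n) from rfl]
    apply treeGaugeAt_delta1_eq_zero hn hr (j := j)
    rw [le_abs]
    rcases hj with h | h
    · left; linarith
    · right; linarith
  have hsum : Summable fun X => |Kfib (tgF (d := d) n) b β w X| :=
    summable_of_ne_finset_zero (s := S) fun X hX => by rw [hzero X hX, abs_zero]
  refine ⟨hsum, ?_⟩
  rw [tsum_eq_sum (s := S) fun X hX => by rw [hzero X hX, abs_zero]]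
  have hcard : S.card = (2 * n + 1) ^ (d + 1) := by
    rw [hS, Fintype.card_piFinset, Finset.prod_congr rfl fun i _ =>
      show (Finset.Icc (w i - n) (w i + n)).card = 2 * n + 1 by
        rw [Int.card_Icc, show w i + (n : ℤ) + 1 - (w i - n) = ((2 * n + 1 : ℕ) : ℤ) by push_cast; ring, Int.toNat_natCast],
      Finset.prod_const, Finset.card_univ, Fintype.card_fin]
  calc ∑ X ∈ S, |Kfib (tgF (d := d) n) b β w X| ≤ ∑ _X ∈ S, ((d : ℝ) + 1) * n :=
        Finset.sum_le_sum fun X _ => by rw [Kfib_apply]; exact abs_tgF_le n w X β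
    _ = ((2 * n + 1) ^ (d + 1) : ℕ) * (((d : ℝ) + 1) * n) := by
        rw [Finset.sum_const, nsmul_eq_mul, hcard]

omit [NeZero p] in
/-- [folklore] **THE LATTICE IDENTITY `dzF ∘ tgF = δ − (Π′ᵀ)_ff`**: `grad λ′_{(β,X)} = δ_{(β,X)} − Π_c δ_{(β,X)}` (`axProjAt_apply`) and
`(Π_c δ_{(β,X)})_α(x) = piK ρ_c n X x (inl β) (inl α)` (`piK_inl_inl_eq` at the root offset `ctrOff (d+1) n`). -/
theorem compF_dzF_tgF :
    compF (dzF (d := d)) (tgF (d := d) n) = kdeltaF - toF (PackedKernelSplit.blk (trK (piK (ctr (d + 1) n) n)) true true) := by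
  have hn : 1 ≤ n := NeZero.one_le
  have hr : ctrOff (d + 1) n ∈ box (d + 1) n := ctrOff_mem_box hn
  funext ⟨x, α⟩ ⟨X, β⟩
  rw [Pi.sub_apply, Pi.sub_apply]
  simp only [compF, Finset.univ_unique, Finset.sum_singleton]
  show ∑' w, dzKer α x w * treeGaugeAt (ctr (d + 1) n) (delta1 β X) n w = _
  rw [tsum_dzKer_mul]
  show _ = kdeltaF (x, α) (X, β) - trK (piK (ctr (d + 1) n) n) x X (Sum.inl α) (Sum.inl β)
  rw [trK_apply, show ctr (d + 1) n = toSite (ctrOff (d + 1) n) from rfl, piK_inl_inl_eq hn hr, axProjAt_apply, delta1_apply, kdeltaF]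
  simp only [Prod.mk.injEq]
  by_cases h1 : x = X
  · by_cases h2 : α = β
    · simp [h1, h2]
    · simp [h2]
  · simp [h1]

/-! ## §3 `ĝrad · N̂′F = 1 − ((Π′ᵀ)_ff)^` on the fine torus; `Π̂′` re-indexed; `Ŵ′₀ = ĝrad · N̂′` -/

/-- [folklore] Fibres of the ff block of `Π̂′ᵀ` are summable (`spr_trK_piK`). -/
theorem summable_Kfib_blk_trK_piK_ctr (a b : Fin (d + 1)) (x : Fin (d + 1) → ℤ) :
    Summable (Kfib (toF (PackedKernelSplit.blk (trK (piK (ctr (d + 1) n) n)) true true)) a b x) := by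
  have hn : 1 ≤ n := NeZero.one_le
  obtain ⟨C, δ, hδ, hdec⟩ := (show Spr (trK (piK (ctr (d + 1) n) n)) from spr_trK_piK hn (ctrOff_mem_box (d := d + 1) hn))
  exact (summable_abs_row hdec hδ x (Sum.inl a) (Sum.inl b)).of_abs

/-- [folklore] **`ĝrad · N̂′F = 1 − ((Π′ᵀ)_ff)^` ON THE FINE TORUS** (`compF_dzF_tgF` periodised by the product rule `periodiseF_compF_matrix`). -/
theorem gradHat_mul_NhatFC :
    gradHat (d := d) (n * p) * NhatFC (d := d) n (n * p)
      = 1 - Matrix.of (periodiseF (n * p) (toF (PackedKernelSplit.blk (trK (piK (ctr (d + 1) n) n)) true true))) := by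
  rw [gradHat_mul_NhatFC_eq, ← periodiseF_compF_matrix (summable_abs_dzF) (isPeriodic₂_tgF n p) (rowBound_tgF n),
    compF_dzF_tgF n, periodiseF_sub_matrix (summable_Kfib_kdeltaF) (summable_Kfib_blk_trK_piK_ctr n), periodiseF_kdeltaF_matrix]

omit [NeZero p] in
/-- [folklore] The ff block of `Π̂′ᵀ` is block covariant. -/
theorem shiftK_blk_trK_piK_ctr (t : Fin (d + 1) → ℤ) :
    shiftK ((n : ℤ) • t) (PackedKernelSplit.blk (trK (piK (ctr (d + 1) n) n)) true true)
      = PackedKernelSplit.blk (trK (piK (ctr (d + 1) n) n)) true true := by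
  show PackedKernelSplit.blk (shiftK ((n : ℤ) • t) (trK (piK (ctr (d + 1) n) n))) true true = _
  rw [shiftK_trK_piK_ctr]

/-- [folklore] **PART 1's `Π̂′` IS THE FINE-TORUS `((Π′ᵀ)_ff)^` RE-INDEXED BY `e₁`** (`SortedEmbedding.periodiseF_reblock_eq_submatrix`). -/
theorem PiHatC_eq_submatrix :
    PiHatC (d := d) n p = (Matrix.of (periodiseF (n * p) (toF (PackedKernelSplit.blk (trK (piK (ctr (d + 1) n) n)) true true)))).submatrix
      (e₁ n p) (e₁ n p) := by
  rw [PiHatC, fTL_sortK]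
  exact periodiseF_reblock_eq_submatrix (fun a b => isPeriodic₂_of_blockCov (shiftK_blk_trK_piK_ctr n) p a b)
    (fun a b x => summable_Kfib_blk_trK_piK_ctr n a b x)

/-- [folklore] **`1 − Π̂′ = (ĝrad · N̂′F)` re-indexed by `e₁`.** -/
theorem one_sub_PiHatC_eq :
    1 - PiHatC (d := d) n p = (gradHat (d := d) (n * p) * NhatFC (d := d) n (n * p)).submatrix (e₁ n p) (e₁ n p) := by
  rw [gradHat_mul_NhatFC n p, Matrix.submatrix_sub, Pi.sub_apply, Pi.sub_apply, Matrix.submatrix_one_equiv, PiHatC_eq_submatrix n p]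

/-- [folklore] Right multiplication by `τ_Tᵀ` picks the comb columns (root `ρ_c`). -/
theorem mul_tauT_transpose_apply_ctr (M : Matrix (I d n p) (I d n p) ℝ) (i : I d n p) (b : CombRows (ctr (d + 1) n) n p) :
    (M * (tauT (ctr (d + 1) n) n p)ᵀ) i b = M i b.1 := by
  rw [Matrix.mul_apply]
  simp only [Matrix.transpose_apply, tauT_apply, mul_ite, mul_one, mul_zero, Finset.sum_ite_eq', Finset.mem_univ, if_true]

/-- [folklore] **`Ŵ′₀ = ĝrad · N̂′`**: the (III′) gauge-basis matrix of PART 1 is the fine-torus gradient of the basis matrix `N̂′` (rows re-indexed to the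
sorted currency by `e₁`). -/
theorem What0C_eq_grad_NhatC :
    What0C (d := d) n p = (gradHat (d := d) (n * p)).submatrix (e₁ n p) id * NhatC (d := d) n p := by
  ext i b
  rw [What0C, mul_tauT_transpose_apply_ctr, one_sub_PiHatC_eq n p, Matrix.submatrix_apply, Matrix.mul_apply, Matrix.mul_apply]
  rfl

end Summit.QuantumFields.BalabanUV.Beta.D1BFx.TorusGaugeBasisMatrixC

end
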